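import Summits.NavierStokesRegularity.FluidComputer.PalasekTowerBurgersNumberLevelZero

/-!
# REGISTER v2.3′: the Burgers number at level 0 → 1 — the FULL-FIELD reading, sharpened

Companion of `PalasekTowerBurgersNumberLevelZero.lean` (p445941; cell `ns-blowup`, seat
`ns-blowup-ecbridge-8` (g4), planner ASK E8-a). LABEL: MODEL-side register arithmetic over the
Literature theorem `norm_fderiv_burgersVortex_le_sharp` (`BurgersVortexPeakSpeed` v3, p447605):
`‖D(U_s + v)(x)‖ ≤ |γ| + |c|` everywhere — the swirl gradient of the Burgers vortex is at most its core
rotation rate `|c| = |γΓ|/(8πν)` (indeed at most the local angular velocity `|c|φ(aρ)`), not `3|c|`.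
Consequently the «strain floor missed everywhere» criterion and the full-field λ-floor of the level-1
child core sharpen: `λ(1 + 0.2481·C) ≤ 3.58` ⇒ missed everywhere (`_strainFloor_missed_zero_sharp`);
velocity-ceiling respected ∧ strain floor met SOMEWHERE on `U_s + v` ⇒ `3.58 < λ(1 + 0.2481·C)` and
**`λ > 0.28`** (`_lambda_floor_zero_sharp`; p445941 certified only `0.035` under this reading) — against
`λ > 0.33` under the AXIS reading (`_lambda_floor_axis_zero`): the two readings of the planner's
`λ_min` now agree to within `0.05`.

WHAT THIS IS NOT: not NS — nothing about registered flows; the Burgers vortex is an infinite-energy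
steady profile. References: P. G. Saffman, *Vortex Dynamics*, CUP 1992, §13.3 (9), (12)
[cite: Saffman1992, §13.3 eq. (12)]; S. Palasek, arXiv:2605.13827, §3 (3.2)
[cite: Palasek2026ElementaryModel, §3 (3.2)].
-/

namespace Summit.NavierStokesRegularity.FluidComputer.PalasekTowerClayBridge

open Real
open Literature.Analysis.FluidPDE

/-- Numerics: `25.13273 < 8π`. -/
private theorem eight_pi_gt' : (25.13273 : ℝ) < 8 * π := by
  have := Real.pi_gt_d6
  linarith

/-! ## The sharp full-field criteria -/

/-- **The strain floor is missed EVERYWHERE on the Burgers child core (sharp form, every level)** when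
`λ A_k · (1 + C N_{k+1}^{β−2}/(8π)) < c₁ A_{k+1}` (strain rate plus core rotation rate below the
floor). -/
theorem palasekTowerBreakdown_burgers_strainFloor_missed_sharp (R : TowerRates) (k : ℕ) {C l c₁ : ℝ}
    (hC : 0 ≤ C) (hl : 0 < l)
    (hP : l * R.A k * (1 + (C * R.N (k + 1) ^ (R.β - 2)) / (8 * π)) < c₁ * R.A (k + 1))
    (x : EuclideanSpace ℝ (Fin 3)) :
    ‖fderiv ℝ (burgersVortex (l * R.A k) 1 (C * R.N (k + 1) ^ (R.β - 2))) x‖ < c₁ * R.A (k + 1) := by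
  have hA := R.A_pos k
  have hγ : 0 < l * R.A k := mul_pos hl hA
  have h := (norm_fderiv_burgersVortex_le_sharp hγ one_pos (C * R.N (k + 1) ^ (R.β - 2)) x).2
  refine h.trans_lt ?_
  have hNp : 0 ≤ R.N (k + 1) ^ (R.β - 2) := Real.rpow_nonneg (R.N_pos _).le _
  have hpi := Real.pi_pos
  have hnn : 0 ≤ l * R.A k * (C * R.N (k + 1) ^ (R.β - 2)) / (8 * π * 1) := by positivity
  rw [abs_of_pos hγ, abs_of_nonneg hnn]
  have : l * R.A k + l * R.A k * (C * R.N (k + 1) ^ (R.β - 2)) / (8 * π * 1) =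
      l * R.A k * (1 + (C * R.N (k + 1) ^ (R.β - 2)) / (8 * π)) := by
    simp only [mul_one]
    ring
  rw [this]
  exact hP

/-- **Sharp form at level `0 → 1`**: the strain floor `S.c₁ · A₁` is missed everywhere on the full
Burgers field when `λ(1 + 0.2481·C) ≤ 3.58` (`N₁^{β−2}/(8π) < 6.234/25.1327 < 0.2481`, `3.58A₀ < A₁`). -/
theorem palasekTowerBreakdown_burgers_strainFloor_missed_zero_sharp (S : Schedule TowerRates.wide)
    (hS : S.Rigid) {C l : ℝ} (hC : 0 ≤ C) (hl : 0 < l) (hP : l * (1 + 0.2481 * C) ≤ 3.58)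
    (x : EuclideanSpace ℝ (Fin 3)) :
    ‖fderiv ℝ (burgersVortex (l * TowerRates.wide.A 0) 1
        (C * TowerRates.wide.N 1 ^ (TowerRates.wide.β - 2))) x‖ < S.c₁ * TowerRates.wide.A 1 := by
  refine palasekTowerBreakdown_burgers_strainFloor_missed_sharp TowerRates.wide 0 hC hl ?_ x
  rw [hS.c₁_eq, one_mul]
  have c8 := eight_pi_gt'
  obtain ⟨-, hN⟩ := TowerRates.wide_N_one_rpow_bounds
  obtain ⟨hA, -⟩ := wide_A_one_div_A_zero_bounds
  have hA0 : 0 < TowerRates.wide.A 0 := TowerRates.wide.A_pos 0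
  have hN0 : 0 ≤ TowerRates.wide.N 1 ^ (TowerRates.wide.β - 2) :=
    Real.rpow_nonneg (TowerRates.wide.N_pos 1).le _
  have hq : (C * TowerRates.wide.N 1 ^ (TowerRates.wide.β - 2)) / (8 * π) ≤ 0.2481 * C := by
    rw [div_le_iff₀ (by positivity)]
    nlinarith [mul_le_mul_of_nonneg_left hN.le hC]
  calc l * TowerRates.wide.A 0 * (1 + (C * TowerRates.wide.N 1 ^ (TowerRates.wide.β - 2)) / (8 * π))
      ≤ l * TowerRates.wide.A 0 * (1 + 0.2481 * C) := by
        refine mul_le_mul_of_nonneg_left (by linarith) (by positivity)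
    _ = l * (1 + 0.2481 * C) * TowerRates.wide.A 0 := by ring
    _ ≤ 3.58 * TowerRates.wide.A 0 := mul_le_mul_of_nonneg_right hP hA0.le
    _ < TowerRates.wide.A 1 := hA

/-- **λ-floor, FULL-FIELD READING, sharp form**: if the level-1 Burgers child core does not overshoot
`S.c₂ · Y₁` anywhere and the strain floor `S.c₁ · A₁` is met SOMEWHERE on the full field `U_s + v`,
then `3.58 < λ(1 + 0.2481·C)` and **`0.28 < λ`** (`Cλ < 25.116√λ`; the axis reading gives `0.33`). -/
theorem palasekTowerBreakdown_burgers_lambda_floor_zero_sharp (S : Schedule TowerRates.wide)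
    (hS : S.Rigid) {C l : ℝ} (hC : 0 ≤ C) (hl : 0 < l)
    (hceil : ∀ x : EuclideanSpace ℝ (Fin 3),
      ‖burgersVortexSwirl (l * TowerRates.wide.A 0) 1
          (C * TowerRates.wide.N 1 ^ (TowerRates.wide.β - 2)) x‖ ≤ S.c₂ * TowerRates.wide.Y 1)
    (hstrain : ∃ x : EuclideanSpace ℝ (Fin 3), S.c₁ * TowerRates.wide.A 1 ≤
      ‖fderiv ℝ (burgersVortex (l * TowerRates.wide.A 0) 1
        (C * TowerRates.wide.N 1 ^ (TowerRates.wide.β - 2))) x‖) :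
    3.58 < l * (1 + 0.2481 * C) ∧ 0.28 < l := by
  have hcap := palasekTowerBreakdown_burgers_ceiling_cap_zero S hS hC hl hceil
  have h1 : 3.58 < l * (1 + 0.2481 * C) := by
    by_contra h
    push Not at h
    obtain ⟨x, hx⟩ := hstrain
    exact absurd hx (not_le.2
      (palasekTowerBreakdown_burgers_strainFloor_missed_zero_sharp S hS hC hl h x))
  refine ⟨h1, ?_⟩
  have hs : 0 ≤ Real.sqrt l := Real.sqrt_nonneg _
  have hsq : Real.sqrt l ^ 2 = l := Real.sq_sqrt hl.le
  have hP : 0 ≤ C * Real.sqrt l := mul_nonneg hC hs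
  -- `l · C = √l · (C√l) ≤ 25.116 √l`
  have h2 : l * C ≤ 25.116 * Real.sqrt l := by
    rw [show l * C = Real.sqrt l * (C * Real.sqrt l) by
      rw [show l * C = Real.sqrt l ^ 2 * C by rw [hsq]]; ring]
    nlinarith [mul_le_mul_of_nonneg_left hcap.le hs]
  by_contra h
  push Not at h
  -- `√l ≤ 0.52916`
  have h3 : Real.sqrt l ≤ 0.52916 := by
    rw [Real.sqrt_le_left (by norm_num)]
    linarith
  nlinarith

/-- **THE LEVEL-`0 → 1` BURGERS POLYTOPE, full-field reading (sharp)**: velocity floor on the core,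
no overshoot anywhere, strain floor somewhere on the full field ⇒ `13.46 < C√λ < 25.12`,
`3.58 < λ(1 + 0.2481·C)`, `0.28 < λ`. -/
theorem palasekTowerBreakdown_burgers_polytope_zero_fullField (S : Schedule TowerRates.wide)
    (hS : S.Rigid) {C l : ℝ} (hC : 0 ≤ C) (hl : 0 < l)
    (hfloor : ∃ x : EuclideanSpace ℝ (Fin 3), S.c₁ * TowerRates.wide.Y 1 ≤
      ‖burgersVortexSwirl (l * TowerRates.wide.A 0) 1
          (C * TowerRates.wide.N 1 ^ (TowerRates.wide.β - 2)) x‖)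
    (hceil : ∀ x : EuclideanSpace ℝ (Fin 3),
      ‖burgersVortexSwirl (l * TowerRates.wide.A 0) 1
          (C * TowerRates.wide.N 1 ^ (TowerRates.wide.β - 2)) x‖ ≤ S.c₂ * TowerRates.wide.Y 1)
    (hstrain : ∃ x : EuclideanSpace ℝ (Fin 3), S.c₁ * TowerRates.wide.A 1 ≤
      ‖fderiv ℝ (burgersVortex (l * TowerRates.wide.A 0) 1
        (C * TowerRates.wide.N 1 ^ (TowerRates.wide.β - 2))) x‖) :
    (13.46 < C * Real.sqrt l ∧ C * Real.sqrt l < 25.12) ∧ 3.58 < l * (1 + 0.2481 * C) ∧ 0.28 < l :=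
  ⟨palasekTowerBreakdown_burgers_band_zero S hS hC hl hfloor hceil,
    palasekTowerBreakdown_burgers_lambda_floor_zero_sharp S hS hC hl hceil hstrain⟩

end Summit.NavierStokesRegularity.FluidComputer.PalasekTowerClayBridge
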